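import Literature.NumberTheory.LFunctions.DobnerSelbergClass
import Literature.Analysis.Complex.DeBruijnUniversalFactorsThm13
import Literature.NumberTheory.LFunctions.SelbergClassRiemannZetaProofs
import Literature.NumberTheory.LFunctions.SelbergClassDirichletProofs
import Mathlib.Analysis.Calculus.Deriv.Star
import HarnessLib

/-!
# Dobner's `𝒮♯` set-up: first discharges (companion of `DobnerSelbergClass.lean`)

RH-FREE literature proofs. Trunk T-ANT (`Literature/NumberTheory/LFunctions`). Everything here is
PROVED (no named facts); statements file: `DobnerSelbergClass.lean` (A. Dobner, *A proof of
Newman's conjecture for the extended Selberg class*, Acta Arith. 201 (2021) = arXiv:2005.05142,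
§§1–2, pp. 3–7 of the held arXiv text).

## Contents (all CONTENT proofs — no ex-falso-from-`Λ ≥ 0` discharge)

* `Literature.NumberTheory.LFunctions.rootsInStrip_trigIntegral_gaussian_of_pos` — **Dobner's
  Thm. 3** (p. 6) in the printed parametrisation (`G_t(z) = ∫ e^{tu²} φ(u) e^{izu} du`, `t > 0`,
  strip `√max(Δ² − 2t, 0)`), a corollary of the tree theorem
  `Literature.Analysis.Complex.DeBruijn1950.thm13_holds` (de Bruijn 1950, Thm. 13, `λ² = 2t`).
* `Literature.NumberTheory.LFunctions.ExtendedSelbergDatum.exists_of_selbergDatum` — the inclusion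
  `𝒮 ⊆ 𝒮♯` on Selberg data whose `polarOrder` is the exact order of the pole at `s = 1`
  (Dobner's condition (iii) pins `m` to the pole order): `γ = β sᵐ(s−1)ᵐ Qˢ ∏ Γ(λⱼ s + μⱼ)` with
  `β² = conj ω` turns Selberg's `Φ(s) = ω conj Φ(1 − conj s)` into Dobner's
  `ξ^F(s) = conj ξ^F(1 − conj s)`; and `isInExtendedSelbergClass_of_selbergDatum`.
* `Literature.NumberTheory.LFunctions.isInExtendedSelbergClass_riemannZeta`,
  `Literature.NumberTheory.LFunctions.isInExtendedSelbergClass_LFunction` — "This class contains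
  the Riemann zeta function as well as all Dirichlet `L`-functions associated to primitive
  characters" (p. 3), from the tree theorems `exists_selbergDatum_riemannZeta_holds`
  (+ Mathlib `riemannZeta_residue_one` for the exact order `m = 1`) and
  `exists_selbergDatum_LFunction_holds` (`m = 0`).

* (appended) `Literature.NumberTheory.LFunctions.ExtendedSelbergDatum.exists_entire_xi` — **`ξ^F`
  is entire** (p. 5: "(ii) and (iii) imply that `ξ^F` is an entire function"): an entire `Ξ` with
  `Ξ = γ F` on `{Re s > 0} ∖ {1}` and the functional equation `Ξ(s) = conj Ξ(1 − conj s)` for ALL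
  `s` (so the strip form of (iii) in `ExtendedSelbergDatum` is equivalent to the printed one);
  `ExtendedSelbergDatum.xi_critical_line_im` — `H(x) = ξ^F((1+ix)/2)` is real (p. 6).

Not here (yet): the full inclusion `𝒮 ⊆ 𝒮♯` (re-choosing `m` as the exact pole order of an
arbitrary Selberg datum), the discharges of `dobner_lemma1` / `dobner_lemma2` /
`dobner_theorem1` / `dobner_theorem2`, and `D.Ht = 8 H_t` for the `ζ`-datum (Fourier inversion).

bears_on: N-C/N-P (COLUMN 3 DBN). WHAT THIS IS NOT: nothing here bears on the truth of RH.

## References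

* A. Dobner, arXiv:2005.05142 = Acta Arith. 201 (2021): §1 p. 3 (`ζ`, Dirichlet `L ∈ 𝒮♯`),
  §2 p. 5 (`𝒮♯` "captures only the analytic properties among those given by Selberg"), Thm. 3 p. 6.
* N. G. de Bruijn, *The roots of trigonometric integrals*, Duke Math. J. 17 (1950), Thm. 13.
-/

noncomputable section

open Complex Filter Set
open scoped ComplexConjugate

namespace Literature.NumberTheory.LFunctions

/-- **Dobner 2021, Thm. 3** in the printed parametrisation (= de Bruijn 1950, Thm. 13 with
`λ² = 2t`): if `φ` is admissible (integrable, `φ(u) = conj φ(−u)`, `φ = O(e^{−|u|^b})`, `b > 2`)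
and all roots of `G(z) = ∫ φ(u) e^{izu} du` lie in `|Im z| ≤ Δ`, then for `t > 0` all roots of
`G_t(z) = ∫ e^{tu²} φ(u) e^{izu} du` lie in `|Im z| ≤ √max(Δ² − 2t, 0)`. Proof: the tree theorem
`Literature.Analysis.Complex.DeBruijn1950.thm13_holds`. [cite: Dobner2021, Thm. 3] -/
theorem rootsInStrip_trigIntegral_gaussian_of_pos {φ : ℝ → ℂ}
    (hφ : Literature.Analysis.Complex.DeBruijn1950.IsAdmissible φ) {Δ : ℝ} (hΔ : 0 ≤ Δ)
    (hroots : Literature.Analysis.Complex.RootsInStrip (Literature.Analysis.Complex.trigIntegral φ) Δ)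
    {t : ℝ} (ht : 0 < t) :
    Literature.Analysis.Complex.RootsInStrip
      (Literature.Analysis.Complex.trigIntegral fun u ↦ ((Real.exp (t * u ^ 2) : ℝ) : ℂ) * φ u)
      (Real.sqrt (max (Δ ^ 2 - 2 * t) 0)) := by
  have h := Literature.Analysis.Complex.DeBruijn1950.thm13_holds φ Δ (Real.sqrt (2 * t)) hΔ hφ hroots
  have h2t : Real.sqrt (2 * t) ^ 2 = 2 * t := Real.sq_sqrt (by linarith)
  have hfun : (fun u : ℝ ↦ φ u * ((Real.exp (Real.sqrt (2 * t) ^ 2 * u ^ 2 / 2) : ℝ) : ℂ)) =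
      fun u ↦ ((Real.exp (t * u ^ 2) : ℝ) : ℂ) * φ u := by
    funext u
    rw [mul_comm, h2t]
    congr 3
    ring
  have hmax : max (Δ ^ 2 - Real.sqrt (2 * t) ^ 2) 0 = max (Δ ^ 2 - 2 * t) 0 := by rw [h2t]
  rw [hfun, hmax] at h
  exact h

namespace ExtendedSelbergDatum

/-- A square root `β` of `conj ω`: `β² = conj ω`. [folklore] -/
private theorem sq_cpow_inv_two (ω : ℂ) : (conj ω ^ ((2 : ℕ) : ℂ)⁻¹) ^ 2 = conj ω :=
  Complex.cpow_nat_inv_pow _ two_ne_zero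

/-- **`𝒮 ⊆ 𝒮♯` on data with exact polar order.** A Selberg datum `D` (Selberg 1992) whose
`polarOrder` `m` is the exact order of the pole at `s = 1` — i.e. `(s−1)ᵐ F(s)` has a non-zero
limit at `1` when `m > 0` — yields an extended Selberg datum with the same function and
coefficients: `γ(s) = β sᵐ(s−1)ᵐ Qˢ ∏ Γ(λⱼ s + μⱼ)` with `β² = conj ω`, since
`conj((1 − conj s)ᵐ(−conj s)ᵐ) = sᵐ(s−1)ᵐ` and `Φ(s) = ω conj Φ(1 − conj s)` gives
`β Φ(s) = conj β · conj Φ(1 − conj s)` (`β ω = conj β` as `|β| = 1`). (Dobner, p. 3: "This class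
contains the Riemann zeta function as well as all Dirichlet `L`-functions"; p. 5: `𝒮♯` keeps only
the analytic axioms of `𝒮`.) [cite: Dobner2021, §2 p. 5] -/
theorem exists_of_selbergDatum (D : SelbergDatum)
    (hm : 0 < D.polarOrder → ∃ c : ℂ, c ≠ 0 ∧
      Tendsto (fun s ↦ (s - 1) ^ D.polarOrder * D.toFun s) (nhdsWithin 1 {1}ᶜ) (nhds c)) :
    ∃ E : ExtendedSelbergDatum, E.toFun = D.toFun ∧ E.coeff = D.coeff ∧
      E.polarOrder = D.polarOrder ∧ E.numGamma = D.numGamma := by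
  -- the constant `β`, `β² = conj ω`, `‖β‖ = 1`
  set β : ℂ := conj D.rootNumber ^ ((2 : ℕ) : ℂ)⁻¹ with hβ
  have hβ2 : β ^ 2 = conj D.rootNumber := sq_cpow_inv_two _
  have hβnorm : ‖β‖ = 1 := by
    have h1 : ‖β‖ ^ 2 = 1 := by
      rw [← norm_pow, hβ2, Complex.norm_conj, D.norm_rootNumber]
    nlinarith [norm_nonneg β]
  have hβ0 : β ≠ 0 := fun h ↦ by simp [h] at hβnorm
  have hβconj : β * D.rootNumber = conj β := by
    have hωω : conj D.rootNumber * D.rootNumber = 1 := by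
      rw [mul_comm, Complex.mul_conj, Complex.normSq_eq_norm_sq, D.norm_rootNumber]; norm_num
    have hbb : conj β * β = 1 := by
      rw [mul_comm, Complex.mul_conj, Complex.normSq_eq_norm_sq, hβnorm]; norm_num
    calc β * D.rootNumber = conj β * β * β * D.rootNumber := by rw [hbb, one_mul]
      _ = conj β * (β ^ 2 * D.rootNumber) := by ring
      _ = conj β := by rw [hβ2, hωω, mul_one]
  -- the entire continuation with exact order
  obtain ⟨G, hGd, hG⟩ := D.differentiable
  have hG1 : 0 < D.polarOrder → G 1 ≠ 0 := by
    intro hpos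
    obtain ⟨c, hc, hlim⟩ := hm hpos
    have hGlim : Tendsto G (nhdsWithin 1 {1}ᶜ) (nhds (G 1)) :=
      (hGd 1).continuousAt.tendsto.mono_left nhdsWithin_le_nhds
    have heq : ∀ᶠ s in nhdsWithin (1 : ℂ) {1}ᶜ, (s - 1) ^ D.polarOrder * D.toFun s = G s :=
      eventually_nhdsWithin_of_forall fun s hs ↦ (hG s hs).symm
    have : G 1 = c := tendsto_nhds_unique hGlim (hlim.congr' heq)
    rwa [this]
  refine
    ⟨{ coeff := D.coeff, toFun := D.toFun, polarOrder := D.polarOrder, alpha := β, Q := D.Q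
       numGamma := D.numGamma, omega := D.lam, mu := D.mu
       exists_ne_zero := ⟨2, by norm_num, D.toFun_ne_zero_of_one_lt_re 2 (by norm_num)⟩
       summable := D.LSeriesSummable_coeff, eqOn_LSeries := D.eqOn_LSeries
       differentiable := ⟨G, hGd, hG, hG1⟩, finiteOrder := D.finiteOrder, alpha_ne_zero := hβ0
       Q_pos := D.Q_pos, omega_pos := D.lam_pos, mu_re_nonneg := D.mu_re_nonneg
       functional_equation := fun s hs₀ hs₁ ↦ ?_ }, rfl, rfl, rfl, rfl⟩
  -- the functional equation
  have hFE := D.functional_equation s hs₀ hs₁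
  set m := D.polarOrder
  set Φ₁ : ℂ := (D.Q : ℂ) ^ s * (∏ j, Complex.Gamma ((D.lam j : ℂ) * s + D.mu j)) * D.toFun s
    with hΦ₁
  set Φ₂ : ℂ := (D.Q : ℂ) ^ (1 - conj s) *
    (∏ j, Complex.Gamma ((D.lam j : ℂ) * (1 - conj s) + D.mu j)) * D.toFun (1 - conj s) with hΦ₂
  have hP : conj ((1 - conj s) ^ m * (1 - conj s - 1) ^ m) = s ^ m * (s - 1) ^ m := by
    simp only [map_mul, map_pow, map_sub, map_one, Complex.conj_conj]
    rw [← mul_pow, ← mul_pow]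
    congr 1
    ring
  calc dobnerGamma β m D.Q D.lam D.mu s * D.toFun s
      = β * (s ^ m * (s - 1) ^ m) * Φ₁ := by rw [dobnerGamma_apply, hΦ₁]; ring
    _ = β * (s ^ m * (s - 1) ^ m) * (D.rootNumber * conj Φ₂) := by rw [hFE]
    _ = conj β * conj ((1 - conj s) ^ m * (1 - conj s - 1) ^ m) * conj Φ₂ := by
        rw [hP, ← hβconj]; ring
    _ = conj (dobnerGamma β m D.Q D.lam D.mu (1 - conj s) * D.toFun (1 - conj s)) := by
        rw [dobnerGamma_apply, hΦ₂]
        simp only [map_mul]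
        ring

/-- `𝒮 ⊆ 𝒮♯` for functions, on data with exact polar order (see `exists_of_selbergDatum`). [cite: Dobner2021, §2 p. 5] -/
theorem isInExtendedSelbergClass_of_selbergDatum (D : SelbergDatum)
    (hm : 0 < D.polarOrder → ∃ c : ℂ, c ≠ 0 ∧
      Tendsto (fun s ↦ (s - 1) ^ D.polarOrder * D.toFun s) (nhdsWithin 1 {1}ᶜ) (nhds c)) :
    IsInExtendedSelbergClass D.toFun := by
  obtain ⟨E, hE, -⟩ := exists_of_selbergDatum D hm
  exact ⟨E, hE⟩

end ExtendedSelbergDatum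

/-- **`ζ ∈ 𝒮♯`** (Dobner, p. 3: "This class contains the Riemann zeta function"): from `ζ ∈ 𝒮`
with a simple pole (`exists_selbergDatum_riemannZeta_holds`, `polarOrder = 1`) and the residue
`lim_{s→1} (s−1)ζ(s) = 1` (Mathlib `riemannZeta_residue_one`). [cite: Dobner2021, §1 p. 3] -/
theorem isInExtendedSelbergClass_riemannZeta : IsInExtendedSelbergClass riemannZeta := by
  obtain ⟨D, hD, -, hpol⟩ := exists_selbergDatum_riemannZeta_holds
  rw [← hD]
  refine ExtendedSelbergDatum.isInExtendedSelbergClass_of_selbergDatum D fun _ ↦ ⟨1, one_ne_zero, ?_⟩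
  rw [hpol, hD]
  simpa using riemannZeta_residue_one

/-- **Primitive Dirichlet `L`-functions are in `𝒮♯`** (Dobner, p. 3: "This class contains … all
Dirichlet `L`-functions associated to primitive characters"): from `L(·, χ) ∈ 𝒮` with no pole
(`exists_selbergDatum_LFunction_holds`, `polarOrder = 0`), so the exact-order hypothesis of
`ExtendedSelbergDatum.exists_of_selbergDatum` is vacuous. [cite: Dobner2021, §1 p. 3] -/
theorem isInExtendedSelbergClass_LFunction {N : ℕ} [NeZero N] (χ : DirichletCharacter ℂ N)
    (hχ : χ.IsPrimitive) (hN : N ≠ 1) : IsInExtendedSelbergClass χ.LFunction := by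
  obtain ⟨D, hD, -, hpol⟩ := exists_selbergDatum_LFunction_holds χ hχ hN
  rw [← hD]
  exact ExtendedSelbergDatum.isInExtendedSelbergClass_of_selbergDatum D fun h ↦
    absurd h (by rw [hpol]; exact lt_irrefl 0)

/-! ## `ξ^F` is entire, with the functional equation everywhere (appended) -/

namespace ExtendedSelbergDatum

variable (D : ExtendedSelbergDatum)

/-- `γ(s) = [α sᵐ Qˢ ∏ Γ(ωᵢ s + μᵢ)] · (s−1)ᵐ` (the `Γ`-part times the polar factor).
[cite: Dobner2021, §2 (iii), p. 5] -/
theorem gamma_eq_core_mul (s : ℂ) : D.gamma s =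
    (D.alpha * s ^ D.polarOrder * (D.Q : ℂ) ^ s * ∏ i, Complex.Gamma ((D.omega i : ℂ) * s + D.mu i)) *
      (s - 1) ^ D.polarOrder := by
  rw [gamma, dobnerGamma_apply]; ring

/-- The `Γ`-part `α sᵐ Qˢ ∏ Γ(ωᵢ s + μᵢ)` of `γ` is holomorphic on `Re s > 0` ("the `Γ` function has
no poles in the right half-plane", p. 5). [cite: Dobner2021, §2 p. 5] -/
theorem differentiableAt_core {s : ℂ} (hs : 0 < s.re) : DifferentiableAt ℂ
    (fun s : ℂ ↦ D.alpha * s ^ D.polarOrder * (D.Q : ℂ) ^ s *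
      ∏ i, Complex.Gamma ((D.omega i : ℂ) * s + D.mu i)) s := by
  refine DifferentiableAt.mul (DifferentiableAt.mul (DifferentiableAt.mul (differentiableAt_const _)
    (differentiableAt_id.pow _)) ?_) ?_
  · exact differentiableAt_id.const_cpow (Or.inl (by exact_mod_cast D.Q_pos.ne'))
  · refine DifferentiableAt.fun_finsetProd fun i _ ↦ ?_
    refine (Complex.differentiableAt_Gamma _ fun m h ↦ ?_).comp s (by fun_prop)
    have := congrArg Complex.re h
    simp only [Complex.add_re, Complex.mul_re, Complex.ofReal_re, Complex.ofReal_im, zero_mul,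
      sub_zero, Complex.neg_re, Complex.natCast_re] at this
    have h1 : 0 < D.omega i * s.re := mul_pos (D.omega_pos i) hs
    linarith [D.mu_re_nonneg i, m.cast_nonneg (α := ℝ)]

/-- **`ξ^F` is entire** (p. 5: "since the `Γ` function has no poles in the right half-plane, (ii)
and (iii) imply that `ξ^F` is an entire function"): there is an entire `Ξ` with `Ξ = γ F` on
`{Re s > 0} ∖ {1}` satisfying the functional equation `Ξ(s) = conj Ξ(1 − conj s)` for ALL `s`.
Construction: `Ξ₊ = α sᵐ Qˢ ∏Γ(ωᵢ s + μᵢ) · G` on `Re s > 0` (`G` the entire continuation of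
`(s−1)ᵐ F`), `Ξ₋(s) = conj Ξ₊(1 − conj s)` on `Re s < 1`, equal on the strip by (iii), glued.
[cite: Dobner2021, §2 p. 5] -/
theorem exists_entire_xi : ∃ Ξ : ℂ → ℂ, Differentiable ℂ Ξ ∧
    (∀ s : ℂ, 0 < s.re → s ≠ 1 → Ξ s = D.xi s) ∧ (∀ s : ℂ, Ξ s = conj (Ξ (1 - conj s))) := by
  obtain ⟨G, hGd, hG, -⟩ := D.differentiable
  -- `Ξ₊` on `Re s > 0`
  set Xp : ℂ → ℂ := fun s ↦ (D.alpha * s ^ D.polarOrder * (D.Q : ℂ) ^ s *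
    ∏ i, Complex.Gamma ((D.omega i : ℂ) * s + D.mu i)) * G s with hXp
  have hXp_diff : ∀ s : ℂ, 0 < s.re → DifferentiableAt ℂ Xp s := fun s hs ↦
    (D.differentiableAt_core hs).mul (hGd s)
  have hXp_xi : ∀ s : ℂ, s ≠ 1 → Xp s = D.xi s := by
    intro s hs1
    simp only [hXp]
    rw [hG s hs1, xi_apply, gamma_eq_core_mul]; ring
  -- `Ξ₋` on `Re s < 1`
  set Xm : ℂ → ℂ := fun s ↦ conj (Xp (1 - conj s)) with hXm
  have hXm_diff : ∀ s : ℂ, s.re < 1 → DifferentiableAt ℂ Xm s := by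
    intro s hs
    have h1 : DifferentiableAt ℂ (fun u : ℂ ↦ Xp (1 - u)) (conj s) := by
      have h2 : DifferentiableAt ℂ Xp (1 - conj s) := hXp_diff _ (by simp; linarith)
      exact h2.comp (conj s) ((differentiableAt_const _).sub differentiableAt_id)
    have h3 := (differentiableAt_conj_conj_iff (f := fun u : ℂ ↦ Xp (1 - u)) (x := s)).2 h1
    exact h3
  -- agreement on the strip
  have hagree : ∀ s : ℂ, 0 < s.re → s.re < 1 → Xm s = Xp s := by
    intro s h0 h1
    have hs1 : s ≠ 1 := fun h ↦ by rw [h] at h1; simp at h1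
    have hs1' : 1 - conj s ≠ 1 := by
      intro h
      have := congrArg Complex.re h
      simp at this
      linarith
    simp only [hXm]
    rw [hXp_xi _ hs1', hXp_xi _ hs1, ← D.xi_eq_conj_xi s h0 h1]
  -- the glued function
  set Ξ : ℂ → ℂ := fun s ↦ if s.re < 1 / 2 then Xm s else Xp s with hΞ
  have hΞp : ∀ s : ℂ, 0 < s.re → Ξ s = Xp s := by
    intro s hs
    simp only [hΞ]
    split_ifs with h
    · exact hagree s hs (by linarith)
    · rfl
  have hΞm : ∀ s : ℂ, s.re < 1 → Ξ s = Xm s := by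
    intro s hs
    simp only [hΞ]
    split_ifs with h
    · rfl
    · exact (hagree s (by linarith) hs).symm
  refine ⟨Ξ, fun s ↦ ?_, fun s hs hs1 ↦ by rw [hΞp s hs, hXp_xi s hs1], fun s ↦ ?_⟩
  · -- differentiability: `Ξ = Xp` near `s` if `Re s > 0`, `Ξ = Xm` near `s` if `Re s < 1`
    rcases lt_or_ge 0 s.re with hs | hs
    · have hev : Ξ =ᶠ[nhds s] Xp := by
        have ho : IsOpen {z : ℂ | 0 < z.re} := isOpen_lt continuous_const Complex.continuous_re
        filter_upwards [ho.mem_nhds hs] with z hz using hΞp z hz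
      exact (hev.differentiableAt_iff).2 (hXp_diff s hs)
    · have hs' : s.re < 1 := by linarith
      have hev : Ξ =ᶠ[nhds s] Xm := by
        have ho : IsOpen {z : ℂ | z.re < 1} := isOpen_lt Complex.continuous_re continuous_const
        filter_upwards [ho.mem_nhds hs'] with z hz using hΞm z hz
      exact (hev.differentiableAt_iff).2 (hXm_diff s hs')
  · -- the functional equation everywhere
    rcases lt_or_ge s.re 1 with hs | hs
    · have h1 : 0 < (1 - conj s).re := by simp; linarith
      rw [hΞm s hs, hΞp _ h1]
    · have h1 : (1 - conj s).re < 1 := by simp; linarith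
      have h2 : 0 < s.re := by linarith
      rw [hΞp s h2, hΞm _ h1]
      simp only [hXm]
      rw [Complex.conj_conj]
      congr 1
      simp

/-- `ξ^F` is real on the critical line: `H(x) = ξ^F((1+ix)/2)` is real for real `x`
(p. 6: "The functional equation implies that `H(x) = conj H(x)` for any real number `x`").
Here for the pointwise `D.xi`, valid since `(1+ix)/2 ≠ 1` has positive real part.
[cite: Dobner2021, §2 p. 6] -/
theorem xi_critical_line_im (x : ℝ) : (D.xi ((1 + I * x) / 2)).im = 0 := by
  set w : ℂ := (1 + I * x) / 2 with hw
  have hre : w.re = 1 / 2 := by simp [hw]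
  have him : w.im = x / 2 := by simp [hw]
  have h := D.xi_eq_conj_xi w (by rw [hre]; norm_num) (by rw [hre]; norm_num)
  have hfix : 1 - conj w = w := by
    apply Complex.ext
    · simp only [Complex.sub_re, Complex.one_re, Complex.conj_re, hre]; norm_num
    · simp only [Complex.sub_im, Complex.one_im, Complex.conj_im, him]; ring
  rw [hfix] at h
  have := congrArg Complex.im h
  rw [Complex.conj_im] at this
  linarith

end ExtendedSelbergDatum


end Literature.NumberTheory.LFunctions

end
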